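import Literature.AnabelianGeometry.EtaleTheta.MuTwoSettingCLevel
import Literature.AnabelianGeometry.EtaleTheta.Discharge.Sec2Cor218iThetaSubquotients
import HarnessLib

/-!
# [EtTh] §2 over §1: the `Δ_Θ`-subquotient data of `Π^tp_X` are NORMAL in `Π^tp_C` (proof-only;
# W3-L2-02, fields `normal_top` / `normal_bot` of abc-iut-L2-t2's `OrbitEmbedding` at the model)

Mochizuki, *The étale theta function and its Frobenioid-theoretic manifestations*, Publ. RIMS **45**
(2009), §2, Def. 2.7 p. 41 (printed 267): the orbit data `η̈^{Θ,ℤ×μ₂}` are read in `Δ_Θ`, a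
characteristic subquotient of `Π^tp_X ⊆ Π^tp_C`; §1 p. 12: "`(Δ^tp_X)^Θ := Δ^tp_X/[Δ^tp_X,[Δ^tp_X,Δ^tp_X]]`
… `Δ_Θ`" [cite: MochizukiEtTh2009, Def 2.7 p.41].

Cell abc-iut, layer L2, W3-L2-02 (seat abc-iut-L2-d3), PROOF-ONLY (no `def`). For `M : MuTwoSetting p`
and `e : M.CLevelData` (open embedding `inclX : Π^tp_X ↪ Π^tp_C`; conjugation by `g ∈ Π^tp_C` restricts to
the topological automorphism `e.conjX g` of `Π^tp_X`, `MuTwoSettingCLevel`), PROVED: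

* `map_inclX_normal_of_conjX_stable` — a subgroup of `Π^tp_X` stable under every `conjX g` has NORMAL image
  in `Π^tp_C` (the pattern of `CLevelData.map_inclX_GtpY_normal`);
* `map_inclX_ker_toTheta_normal` — `inclX(Ker(Π^tp_X ↠ (Π^tp_X)^Θ)) ⊴ Π^tp_C` (`OrbitEmbedding.normal_bot`);
* `map_inclX_comap_deltaTheta_normal` — `inclX(toTheta⁻¹(Δ_Θ)) ⊴ Π^tp_C` (`OrbitEmbedding.normal_top`);

both from the tree's `ThetaSetting.map_ker_toTheta_eq` / `map_comap_deltaTheta_eq` (invariance under ANY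
topological automorphism `Γ` of `Π^tp_X` with `Γ(Δ^tp_X) = Δ^tp_X`, Discharge/Sec2Cor218iThetaSubquotients)
applied to `Γ := e.conjX g` (`e.map_deltaTemp_conjX g`). No binder. Nothing here asserts that a
`MuTwoSetting` exists; no side is taken on [IUTchIII] Cor. 3.12; typed ≠ proved.
-/

noncomputable section

namespace Literature.AnabelianGeometry.EtaleTheta

namespace MuTwoSetting.CLevelData

variable {p : ℕ} [Fact p.Prime] {M : MuTwoSetting p}

/-- **A `conjX`-stable subgroup of `Π^tp_X` has normal image in `Π^tp_C`.**
[cite: MochizukiEtTh2009, Def 2.7 p.41] -/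
theorem map_inclX_normal_of_conjX_stable (e : M.CLevelData) {H : Subgroup M.PiTemp}
    (h : ∀ g : M.GtpC, H.map (e.conjX g).toMulEquiv.toMonoidHom = H) : (H.map M.inclX).Normal := by
  refine ⟨fun z hz g => ?_⟩
  obtain ⟨y, hy, rfl⟩ := hz
  refine ⟨e.conjX g y, ?_, e.inclX_conjX g y⟩
  have hmem : e.conjX g y ∈ H.map (e.conjX g).toMulEquiv.toMonoidHom := ⟨y, hy, rfl⟩
  rwa [h g] at hmem

/-- **`inclX(Ker(Π^tp_X ↠ (Π^tp_X)^Θ)) ⊴ Π^tp_C`** (abc-iut-L2-t2's `OrbitEmbedding.normal_bot` at the model).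
[cite: MochizukiEtTh2009, Def 2.7 p.41] -/
theorem map_inclX_ker_toTheta_normal (e : M.CLevelData) : (M.toTheta.ker.map M.inclX).Normal :=
  e.map_inclX_normal_of_conjX_stable fun g =>
    M.toThetaSetting.map_ker_toTheta_eq (e.conjX g) (e.map_deltaTemp_conjX g)

/-- **`inclX(toTheta⁻¹(Δ_Θ)) ⊴ Π^tp_C`** (abc-iut-L2-t2's `OrbitEmbedding.normal_top` at the model).
[cite: MochizukiEtTh2009, Def 2.7 p.41] -/
theorem map_inclX_comap_deltaTheta_normal (e : M.CLevelData) :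
    ((M.DeltaTheta.comap M.toTheta).map M.inclX).Normal :=
  e.map_inclX_normal_of_conjX_stable fun g =>
    M.toThetaSetting.map_comap_deltaTheta_eq (e.conjX g) (e.map_deltaTemp_conjX g)

end MuTwoSetting.CLevelData

end Literature.AnabelianGeometry.EtaleTheta

end
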